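import Summits.QuantumFields.YangMills.Theorems.BalabanLadderUVSeamRecResponseMomentsDefs
import HarnessLib

/-!
# Route `UniversalDetector`, LINE g9-3 — the (RM₁) clause of `SchemeResponseLaws` at `SU(2)` is the singleton case of the spine's (RM)

Ideator seat ym-idea-8 (generation 9, lens «dual»); support for the crux item `UniversalDetector.SchemeResponseLaws`
(stmt-QuantumFields-23933), making critic VERDICT #71 P1 concrete: the first conjunct (RM₁) of `SchemeResponseLaws` — singleton
exponential response moments `E_T exp((R⁴/C₁)|E[P_q(x) | links outside Q_R(x)] − p_q(β)|) ≤ e^B` of every plane field on centred femto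
cubes — is, for `G = SU(2)` in the fundamental representation, EXACTLY the one-cube (`n = 1`, `T = univ`) case of the spine's named
binder `ResponseMomentsOdd6SU2` (crux `UVSeamRec`, stmt-QuantumFields-20043, slot `stub_ceilings` v5(α)), AT THE SPINE'S UNIT `a`
(`a ≤ c·uRec` eventually).  So (RM₁) is «staffed by the spine» at that unit; the package `SchemeResponseLaws` still needs (RMH) and
(NONCONTACT) at the SAME unit, which nothing here supplies.

HONEST FRAMING: a one-line specialisation of an OPEN hypothesis (used as such); no response law is proved; no summit is proved by this
line; not Clay.
-/

set_option autoImplicit false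

noncomputable section

open MeasureTheory Filter Topology Finset
open Literature.MathematicalPhysics.QuantumLattice
open Summit.QuantumFields.YangMills.Cruxes.OSLegsFromFemtoAndGap.DlrCollarTransfer
open Summit.QuantumFields.YangMills.Cruxes.UVSeamRec.ResponseMomentsDefs (ResponseMomentsOdd6SU2)
open Summit.QuantumFields.YangMills.Cruxes.UVSeamRec (Transport.uRec)

namespace Summit.QuantumFields.YangMills.Cruxes.UniversalDetectorTightPeeling

/-- **(RM) ⇒ (RM₁) at `SU(2)`, fundamental, at the spine's unit.**  The singleton (`n = 1`) case of the spine's joint response-moment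
binder `ResponseMomentsOdd6SU2` is the first conjunct of `UniversalDetector.SchemeResponseLaws` for `SU(2)` (with the spine's unit `a`,
`a ≤ c·uRec` eventually, and its constants). [folklore] -/
theorem rm1_SU2_of_responseMomentsOdd6SU2 (h : ResponseMomentsOdd6SU2) :
    letI : MeasurableSpace (Matrix.specialUnitaryGroup (Fin 2) ℂ) := borel _
    haveI : BorelSpace (Matrix.specialUnitaryGroup (Fin 2) ℂ) := ⟨rfl⟩
    ∃ (a : ℝ → ℝ) (c : ℝ), 0 < c ∧ (∀ᶠ β in atTop, a β ≤ c * Transport.uRec β) ∧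
      ∃ (p : Fin 4 × Fin 4 → ℝ → ℝ) (C₁ B β₁ ℓ₁ : ℝ), 0 < C₁ ∧ 0 < ℓ₁ ∧
        ∀ β : ℝ, β₁ ≤ β → ∀ (L : ℕ) (q : Fin 4 × Fin 4) (x : Fin 4 → ℤ) (R : ℕ), q.1 < q.2 → 1 ≤ R →
          (R : ℝ) * a β ≤ ℓ₁ → 4 * R + 8 ≤ L →
          torusE (Matrix.specialUnitaryGroup (Fin 2) ℂ) (fundamentalLatticeRep 2) β L
            (fun U => Real.exp ((R : ℝ) ^ 4 / C₁ *
              |kerE (Matrix.specialUnitaryGroup (Fin 2) ℂ) (fundamentalLatticeRep 2) β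
                (fun k => x k - ((R : ℤ) + 1)) (2 * R + 3) U
                (plane (Matrix.specialUnitaryGroup (Fin 2) ℂ) (fundamentalLatticeRep 2) q x) - p q β|)) ≤ Real.exp B := by
  obtain ⟨a, c, C₁, B, β₁, ℓ₁, P₀, p, hc, hac, hℓ₁, hC₁, -, H⟩ := h
  refine ⟨a, c, hc, hac, p, C₁, B, β₁, ℓ₁, hC₁, hℓ₁, ?_⟩
  intro β hβ L q x R hq hR hRa hL
  have h1 := H β hβ L 1 (fun _ => q) (fun _ => x) R (fun _ => hq) hR hRa hL
    (fun i j hij => absurd (Subsingleton.elim i j) hij) Finset.univ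
  simpa using h1

end Summit.QuantumFields.YangMills.Cruxes.UniversalDetectorTightPeeling
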